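import Summits.CriticalPhenomena.CardyFormulaZ2.Theorems.CardySelfDualSegmentUniformMarginalityStubRussoIdentity
import Summits.CriticalPhenomena.CardyFormulaZ2.Theorems.CardySelfDualSegmentUniformMarginalityDefs3
import Summits.CriticalPhenomena.CardyFormulaZ2.Theorems.CardySelfDualSegmentUniformMarginalityMirrorIntegrand
import Summits.CriticalPhenomena.CardyFormulaZ2.Theorems.CardySelfDualSegmentUniformMarginalityMirrorPivotal

/-!
# The Russo census of the corner deformation is a mirror antisymmetrisation (exact `λ⁺ = λ⁻`)

Sub-goal `hasDerivAt_Pext_mirrorCensus` of line `Sketch` for the crux `UniformMarginality`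
(stmt-CriticalPhenomena-5472, route `CardySelfDualSegment`).  Assembly of three landed identities:

* (R) `stub_russoIdentity` (p98128): `∂_t P_t(R,δ) = ½ Σ_{v ∈ K} E_t[(1 − 2c_v) 𝟙{N_v piv A}]`, `A = crossEvent R δ`;
* `integral_russoIntegrand_eq_half_pivotal_sub` (p142358): integrating out the fair coin,
  `E_t[(1 − 2c_v) 𝟙{N_v piv A}] = ½ (M_t{N_v piv A, E_v forced closed} − M_t{N_v piv A, E_v forced open})`;
* `real_isPivotal_insert_eq_real_mirror` (`…MirrorPivotal.lean`): the corner mirror `Ŝ_v` turns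
  "`E_v` forced open for `A`" into "`E_v` forced closed for the mirror event `A^{Ŝ_v}`".

Result (`hasDerivAt_Pext_mirrorCensus`, every conformal rectangle, every mesh `δ > 0`, every `t ∈ (0,1)`):

  `∂_t P_t(R,δ) = ¼ Σ_{v ∈ K} [Π_v^t(A) − Π_v^t(A^{Ŝ_v})]`,  `Π_v^t(B) := M_t{ω | N_v pivotal for B in ω ∖ {E_v}}`.

So the signed census whose mesh-uniform control is the crux (stub (B₁)) is the antisymmetrisation, under
the measure-preserving corner mirrors `Ŝ_v`, of ONE positive functional of increasing events — the exact,
every-mesh form of the cancellation "`λ⁺ = λ⁻`" of the route text: wherever `A` is (nearly) `Ŝ_v`-symmetric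
as seen from `v` the summand (nearly) vanishes, and what (B₁) must bound is the response of the labelled
four-arm corner functional `Π_v` to replacing the far boundary data `A` by its mirror image `A^{Ŝ_v}`
(idea card `and-or-mirror-stress`: spare-arm domination SAD).
-/

noncomputable section

namespace Summit.CriticalPhenomena.CardyFormulaZ2.Cruxes.UniformMarginality.HeatFlow

open MeasureTheory Literature.Probability.Percolation Literature.Probability.LatticeModels
  Literature.Probability.RandomPlanarGeometry

/-- **The Russo integrand in mirror form**: for measurable `A`, every vertex `v` and every real
parameter `s`, `∫ (1 − 2c_v) 𝟙{N_v piv A} dM_s = ½ [Π_v^s(A) − Π_v^s(A^{Ŝ_v})]`. -/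
theorem integral_russoIntegrand_eq_half_mirror (s : ℝ) {A : Set (BondConfig (Site 2))} (hA : MeasurableSet A)
    (v : Site 2) :
    ∫ ω, russoIntegrand A v ω ∂(M s) =
      (1 / 2 : ℝ) * ((M s).real {ω | IsPivotal A (northEdge v) (ω \ {eastEdge v})} -
        (M s).real {ω | IsPivotal (mirrorEvent v A) (northEdge v) (ω \ {eastEdge v})}) := by
  unfold M
  rw [integral_russoIntegrand_eq_half_pivotal_sub _ A hA v, real_isPivotal_insert_eq_real_mirror _ A hA v]

/-- **The Russo census is a mirror antisymmetrisation** (exact, every mesh): for `δ > 0` there is a finite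
set `K` of vertices outside which no north edge is ever pivotal for the crude crossing event
`A = crossEvent R δ`, and at every `t ∈ (0,1)`
`∂_t P_t(R,δ) = ¼ Σ_{v ∈ K} [M_t{N_v piv A, E_v closed} − M_t{N_v piv A^{Ŝ_v}, E_v closed}]`. -/
theorem hasDerivAt_Pext_mirrorCensus : ∀ (R : ConformalRectangle) (δ : ℝ), 0 < δ → ∃ K : Finset (Site 2), (∀ ω, ∀ v ∉ K, ¬ IsPivotal (crossEvent R δ) (northEdge v) ω) ∧ ∀ t ∈ Set.Ioo (0 : ℝ) 1, HasDerivAt (Pext R δ) ((1 / 4 : ℝ) * ∑ v ∈ K, ((M t).real {ω | IsPivotal (crossEvent R δ) (northEdge v) (ω \ {eastEdge v})} - (M t).real {ω | IsPivotal (mirrorEvent v (crossEvent R δ)) (northEdge v) (ω \ {eastEdge v})})) t := by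
  intro R δ hδ
  obtain ⟨K, hK, hderiv⟩ := stub_russoIdentity R δ hδ
  refine ⟨K, hK, fun t ht => ?_⟩
  have key := hderiv t ht
  have hsum : (1 / 2 : ℝ) * ∑ v ∈ K, ∫ ω, russoIntegrand (crossEvent R δ) v ω ∂(M t) =
      (1 / 4 : ℝ) * ∑ v ∈ K, ((M t).real {ω | IsPivotal (crossEvent R δ) (northEdge v) (ω \ {eastEdge v})} -
        (M t).real {ω | IsPivotal (mirrorEvent v (crossEvent R δ)) (northEdge v) (ω \ {eastEdge v})}) := by
    rw [Finset.mul_sum, Finset.mul_sum]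
    refine Finset.sum_congr rfl fun v _ => ?_
    rw [integral_russoIntegrand_eq_half_mirror t (measurableSet_crossEvent R δ) v]
    ring
  rwa [hsum] at key

/-- **`deriv` form of the mirror census.** -/
theorem deriv_Pext_eq_mirrorCensus (R : ConformalRectangle) {δ : ℝ} (hδ : 0 < δ) :
    ∃ K : Finset (Site 2), (∀ ω, ∀ v ∉ K, ¬ IsPivotal (crossEvent R δ) (northEdge v) ω) ∧
      ∀ t ∈ Set.Ioo (0 : ℝ) 1, deriv (Pext R δ) t =
        (1 / 4 : ℝ) * ∑ v ∈ K, ((M t).real {ω | IsPivotal (crossEvent R δ) (northEdge v) (ω \ {eastEdge v})} -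
          (M t).real {ω | IsPivotal (mirrorEvent v (crossEvent R δ)) (northEdge v) (ω \ {eastEdge v})}) := by
  obtain ⟨K, hK, h⟩ := hasDerivAt_Pext_mirrorCensus R δ hδ
  exact ⟨K, hK, fun t ht => (h t ht).deriv⟩

/-- Off the support: if `N_v` is never pivotal for `A`, the corner `v` contributes nothing (both halves vanish,
the mirror half by `real_isPivotal_insert_eq_real_mirror`). -/
theorem mirrorCensus_summand_eq_zero_of_not_pivotal (t : ℝ) {A : Set (BondConfig (Site 2))}
    (hA : MeasurableSet A) (v : Site 2) (h : ∀ ω, ¬ IsPivotal A (northEdge v) ω) :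
    (M t).real {ω | IsPivotal A (northEdge v) (ω \ {eastEdge v})} -
        (M t).real {ω | IsPivotal (mirrorEvent v A) (northEdge v) (ω \ {eastEdge v})} = 0 := by
  unfold M
  rw [← real_isPivotal_insert_eq_real_mirror _ A hA v]
  have h1 : {ω : BondConfig (Site 2) | IsPivotal A (northEdge v) (ω \ {eastEdge v})} = ∅ :=
    Set.eq_empty_of_forall_notMem fun ω hω => h _ hω
  have h2 : {ω : BondConfig (Site 2) | IsPivotal A (northEdge v) (insert (eastEdge v) ω)} = ∅ :=
    Set.eq_empty_of_forall_notMem fun ω hω => h _ hω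
  rw [h1, h2, sub_self]

/-- **The mirror census over the canonical vertex set** `verts R δ` (the vertices whose mesh point lies in
the carrier): `∂_t P_t(R,δ) = ¼ Σ_{v ∈ verts R δ} [Π_v^t(A) − Π_v^t(A^{Ŝ_v})]` — the summand vanishes off the
`K` of `hasDerivAt_Pext_mirrorCensus` and off `verts R δ` (`not_isPivotal_northEdge`). -/
theorem deriv_Pext_eq_mirrorCensus_verts (R : ConformalRectangle) {δ : ℝ} (hδ : 0 < δ) {t : ℝ}
    (ht : t ∈ Set.Ioo (0 : ℝ) 1) :
    deriv (Pext R δ) t =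
      (1 / 4 : ℝ) * ∑ v ∈ (verts_finite R hδ).toFinset,
        ((M t).real {ω | IsPivotal (crossEvent R δ) (northEdge v) (ω \ {eastEdge v})} -
          (M t).real {ω | IsPivotal (mirrorEvent v (crossEvent R δ)) (northEdge v) (ω \ {eastEdge v})}) := by
  classical
  obtain ⟨K, hK, h⟩ := deriv_Pext_eq_mirrorCensus R hδ
  rw [h t ht]
  congr 1
  set f : Site 2 → ℝ := fun v =>
    (M t).real {ω | IsPivotal (crossEvent R δ) (northEdge v) (ω \ {eastEdge v})} -
      (M t).real {ω | IsPivotal (mirrorEvent v (crossEvent R δ)) (northEdge v) (ω \ {eastEdge v})} with hf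
  have hzeroK : ∀ v, v ∉ K → f v = 0 := fun v hv =>
    mirrorCensus_summand_eq_zero_of_not_pivotal t (measurableSet_crossEvent R δ) v fun ω => hK ω v hv
  have hzeroV : ∀ v, v ∉ (verts_finite R hδ).toFinset → f v = 0 := fun v hv =>
    mirrorCensus_summand_eq_zero_of_not_pivotal t (measurableSet_crossEvent R δ) v
      fun ω => not_isPivotal_northEdge R hδ hv ω
  show ∑ v ∈ K, f v = ∑ v ∈ (verts_finite R hδ).toFinset, f v
  rw [← Finset.sum_subset (Finset.inter_subset_left (s₁ := K) (s₂ := (verts_finite R hδ).toFinset))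
      (fun v _ hv' => hzeroV v fun hvV => hv' (Finset.mem_inter.2 ⟨‹v ∈ K›, hvV⟩)),
    ← Finset.sum_subset (Finset.inter_subset_right (s₁ := K) (s₂ := (verts_finite R hδ).toFinset))
      (fun v _ hv' => hzeroK v fun hvK => hv' (Finset.mem_inter.2 ⟨hvK, ‹v ∈ _›⟩))]

/-- **SAD-shaped reduction of stub (B₁) at one rectangle**: if the mirror-odd response of every corner is
dominated termwise by `C` times the `M_t`-probability of some majorant event `F δ t v`, and the majorants are
summable over `verts R δ` uniformly in the mesh and the parameter, then `RussoBoundAt R` and hence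
`IntegratedBoundAt R` (the crux AT `R`, by the landed MVT glue `integratedBoundAt_of`).  With `F` = "`N_v`
pivotal with a spare fifth arm to `∂R`" this is the chain SAD ∧ UBC ⟹ (B₁) of the idea card
`and-or-mirror-stress` (§Transfer); the two hypotheses are its research content. -/
theorem integratedBoundAt_of_mirrorDomination (R : ConformalRectangle)
    (F : ℝ → ℝ → Site 2 → Set (BondConfig (Site 2))) {C C' : ℝ}
    (hdom : ∀ (δ : ℝ) (hδ : 0 < δ), ∀ t ∈ Set.Ioo (0 : ℝ) 1, ∀ v ∈ (verts_finite R hδ).toFinset,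
      |(M t).real {ω | IsPivotal (crossEvent R δ) (northEdge v) (ω \ {eastEdge v})} -
          (M t).real {ω | IsPivotal (mirrorEvent v (crossEvent R δ)) (northEdge v) (ω \ {eastEdge v})}| ≤
        C * (M t).real (F δ t v))
    (hsum : ∀ (δ : ℝ) (hδ : 0 < δ), ∀ t ∈ Set.Ioo (0 : ℝ) 1,
      ∑ v ∈ (verts_finite R hδ).toFinset, (M t).real (F δ t v) ≤ C') :
    IntegratedBoundAt R := by
  refine integratedBoundAt_of R fun t₀ _ => ⟨1, one_pos, |C| * |C'| / 4, fun δ hδ t ht _ => ?_⟩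
  rw [deriv_Pext_eq_mirrorCensus_verts R hδ ht, abs_mul, abs_of_pos (by norm_num : (0 : ℝ) < 1 / 4)]
  have hle : |∑ v ∈ (verts_finite R hδ).toFinset,
      ((M t).real {ω | IsPivotal (crossEvent R δ) (northEdge v) (ω \ {eastEdge v})} -
        (M t).real {ω | IsPivotal (mirrorEvent v (crossEvent R δ)) (northEdge v) (ω \ {eastEdge v})})| ≤
      |C| * |C'| := by
    refine (Finset.abs_sum_le_sum_abs _ _).trans ?_
    have h1 : ∑ v ∈ (verts_finite R hδ).toFinset,
        |(M t).real {ω | IsPivotal (crossEvent R δ) (northEdge v) (ω \ {eastEdge v})} -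
          (M t).real {ω | IsPivotal (mirrorEvent v (crossEvent R δ)) (northEdge v) (ω \ {eastEdge v})}| ≤
        ∑ v ∈ (verts_finite R hδ).toFinset, |C| * (M t).real (F δ t v) := by
      refine Finset.sum_le_sum fun v hv => (hdom δ hδ t ht v hv).trans ?_
      exact mul_le_mul_of_nonneg_right (le_abs_self C) measureReal_nonneg
    refine h1.trans ?_
    rw [← Finset.mul_sum]
    have hs : ∑ v ∈ (verts_finite R hδ).toFinset, (M t).real (F δ t v) ≤ |C'| :=
      (hsum δ hδ t ht).trans (le_abs_self C')
    exact mul_le_mul_of_nonneg_left hs (abs_nonneg C)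
  calc 1 / 4 * |∑ v ∈ (verts_finite R hδ).toFinset,
        ((M t).real {ω | IsPivotal (crossEvent R δ) (northEdge v) (ω \ {eastEdge v})} -
          (M t).real {ω | IsPivotal (mirrorEvent v (crossEvent R δ)) (northEdge v) (ω \ {eastEdge v})})|
      ≤ 1 / 4 * (|C| * |C'|) := by gcongr
    _ = |C| * |C'| / 4 := by ring

/-- **Termwise vanishing at mirror-symmetric data**: if the crossing event looks `Ŝ_v`-symmetric from the
corner `v` in the sense that `Π_v^t(A) = Π_v^t(A^{Ŝ_v})`, the corner `v` contributes nothing to the census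
(the lattice form of "`λ⁺ = λ⁻`": the summand is the `Ŝ_v`-odd response of one functional). -/
theorem mirrorCensus_summand_eq_zero_of_symmetric (t : ℝ) (A : Set (BondConfig (Site 2))) (v : Site 2)
    (hsym : (M t).real {ω | IsPivotal A (northEdge v) (ω \ {eastEdge v})} =
      (M t).real {ω | IsPivotal (mirrorEvent v A) (northEdge v) (ω \ {eastEdge v})}) :
    (M t).real {ω | IsPivotal A (northEdge v) (ω \ {eastEdge v})} -
        (M t).real {ω | IsPivotal (mirrorEvent v A) (northEdge v) (ω \ {eastEdge v})} = 0 :=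
  sub_eq_zero.2 hsym

end Summit.CriticalPhenomena.CardyFormulaZ2.Cruxes.UniformMarginality.HeatFlow

end
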